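import Mathlib
import HarnessLib
import Summits.ResolutionOfSingularities.ResolutionOfSingularities.Theorems.WildQuotientsWildQuotientResolutionS1aRingKillDataOfCert

/-!
# SIG FLAG v1 — signatures for the FLAG FORM of the kill clause (W4.5c, crux `CyclicQuotientFourfolds`, line `s1a-logminvertex` v10, K side)

[OURS · L1 W4.5c · plan-1 g13 · THETA-LP-CENSUS v10 §6] — NOT statements of the manuscript; counted 0; AI planning, weaker than expert review.
SIGNATURES ONLY (every `sorry` intentional; this file is a crux workfile, not a Theorems file). Purpose: make CHAIN v10.26 row (6) precise.

The census (U-OBS: kill rays are unique and locally constant along a bad component; TSP = the points where they disappear) says the (2,1) kill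
filtration of the smooth transversal type is CANONICAL: with `I = (x₁, x₃)` the ideal of the component and `K = (x₁) + I²` ("the kernel of
`φ : I/I² → I/I²`, `ȳ ↦ (σ y − y)/β`"), the weighted filtration is `𝒥ₙ = Σ_{2a+b ≥ n} K^a I^b` — a function of the FLAG `I ⊇ K ⊇ I²` alone (F1, F2),
and `K` is determined by `(I, σ, β)` (F4). Consequence for the K-programme: on the part of a component where flag bases exist locally, the kill charts of
`ringKillData_smoothTransversalType` (p636674) all come from ONE filtration / ONE monomial valuation — the gluing asked by `KillAdmValReach` is free.
F3/F5: the conormal (1,1) sibling (A₁ʼs plane `x₂ = x₃`; every special point over an aux centre on such a component, by the frame row `θ(e)/e`).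
-/

set_option linter.dupNamespace false

noncomputable section

open Literature.AlgebraicGeometry.Resolution
open scoped LaurentPolynomial
open Summit.ResolutionOfSingularities.ResolutionOfSingularities.Theorems.WildQuotientResolution.S1.CoarseChart
open Summit.ResolutionOfSingularities.ResolutionOfSingularities.Theorems.WildQuotientResolution.S1.BlowupCharts
open Summit.ResolutionOfSingularities.ResolutionOfSingularities.Theorems.WildQuotientResolution.S1.KillCert

namespace Summit.ResolutionOfSingularities.ResolutionOfSingularities.Theorems.WildQuotientResolution.S1.FlagSig

universe u

variable {B : Type u} [CommRing B]

/-- **The flag filtration** of a flag of ideals `I ⊇ K ⊇ I²`: `𝒥ₙ = Σ_{2a + b ≥ n} K^a · I^b`. [OURS · L1 W4.5c] -/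
def flagFiltration (I K : Ideal B) (n : ℕ) : Ideal B :=
  ⨆ (a : ℕ) (b : ℕ) (_ : n ≤ 2 * a + b), K ^ a * I ^ b

/-- **F1** (pure algebra, ANY pair `f`): the `(2,1)`-weighted filtration of `(f 0, f 1)` is the flag filtration of `I = (f 0, f 1) ⊇ K = (f 0) + I²`.
[OURS · L1 W4.5c] -/
theorem weightedFiltration_two_one_eq_flag (f : Fin 2 → B) (n : ℕ) :
    (weightedFiltration f ![2, 1]).ideal n =
      flagFiltration (Ideal.span (Set.range f)) (Ideal.span {f 0} ⊔ Ideal.span (Set.range f) ^ 2) n := by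
  sorry

/-- **F2 — CANONICITY**: two flag bases of the same flag (`(f 0, f 1) = (f' 0, f' 1)` as ideals and `(f 0) + I² = (f' 0) + I²`) define the SAME
`(2,1)`-weighted filtration (so the same cobordant blow-up, the same kill charts). [OURS · L1 W4.5c] -/
theorem weightedFiltration_eq_of_flag (f f' : Fin 2 → B) (hI : Ideal.span (Set.range f) = Ideal.span (Set.range f'))
    (hK : Ideal.span {f 0} ⊔ Ideal.span (Set.range f) ^ 2 = Ideal.span {f' 0} ⊔ Ideal.span (Set.range f') ^ 2) (n : ℕ) :
    (weightedFiltration f ![2, 1]).ideal n = (weightedFiltration f' ![2, 1]).ideal n := by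
  sorry

/-- **F3** (the conormal sibling, ANY pair `f`): the `(1,1)`-weighted filtration is the `I`-adic one. [OURS · L1 W4.5c] -/
theorem weightedFiltration_one_one_eq_pow (f : Fin 2 → B) (n : ℕ) :
    (weightedFiltration f ![1, 1]).ideal n = Ideal.span (Set.range f) ^ n := by
  sorry

/-- **F4 ★ — `K` is determined by `(I, σ, β)`** ("`K = ker φ`"): under boundary-admissibility for the `(2,1)` filtration and the smooth-transversal row
`σ x₃ − x₃ ≡ β h x₁ (mod β 𝒥₃)` with `h` a unit, `β` a non-zero-divisor and `(x₁, x₃)` a regular sequence, an element `y ∈ I` satisfies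
`σ y − y ∈ β I²` iff `y ∈ (x₁) + I²`. (⇐: twisted Leibniz; ⇒: `y = a x₁ + b x₃` gives `σ y − y ≡ β b h x₁ (mod β I²)`, and `b h x₁ ∈ I²` forces `b ∈ I`
because `I/I²` is free over `B/I` on `x̄₁, x̄₃` — quasi-regularity of a regular sequence, Matsumura Thm 16.2.) [OURS · L1 W4.5c] -/
theorem mem_flag_iff (σ : B ≃+* B) (f : Fin 2 → B) (β h : B) (hh : IsUnit h) (hβ : β ∈ nonZeroDivisors B)
    (hK1 : RingTheory.Sequence.IsRegular B (List.ofFn f))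
    (hadm : ∀ (n : ℕ) (y : B), y ∈ (weightedFiltration f ![2, 1]).ideal n →
      σ y - y ∈ Ideal.span {β} * (weightedFiltration f ![2, 1]).ideal (n + 1))
    (h₃ : σ (f 1) - f 1 - β * h * f 0 ∈ Ideal.span {β} * (weightedFiltration f ![2, 1]).ideal 3)
    (y : B) (hy : y ∈ Ideal.span (Set.range f)) :
    σ y - y ∈ Ideal.span {β} * Ideal.span (Set.range f) ^ 2 ↔ y ∈ Ideal.span {f 0} ⊔ Ideal.span (Set.range f) ^ 2 := by
  sorry

/-- **F5 — THE CONORMAL (1,1) TYPE** (KC2 ∘ KC3 ∘ a KC4-clone; A₁ʼs plane `x₂ = x₃`: `θ(x₂) = x₁`, `θ(x₄) = z·y` with `z` a unit off the other plane;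
every special point over an aux centre on such a component via the frame row `θ(e)/e = x₁`): centre `(x₁, y) = (f 0, f 1)` with weights `(1, 1)`,
K1′-regular with a Veronese degree; boundary-admissible for `β` (generators + centre rows in `β 𝒥₂`); isolated; and weight-0 elements `y₃, y₄` with
`σ y₃ − y₃ ≡ β h x₁`, `σ y₄ − y₄ ≡ β u y (mod β 𝒥₂)`, `h, u` units ⇒ `RingKillData`: principal augmentation ideal `(β s)` on every σ-fixed chart, all `p`.
[OURS · L1 W4.5c] -/
theorem ringKillData_conormalType {p : ℕ} {m : ℕ} (r : Fin m → ℕ) (𝒜 : (Π j : Fin m, ZMod (r j)) → AddSubgroup B) [GradedRing 𝒜]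
    (σ : B ≃+* B) (f : Fin 2 → B) (δ : Fin 2 → Π j : Fin m, ZMod (r j)) (d : ℕ) (hf : ∀ i, f i ∈ 𝒜 (δ i))
    (hK1 : RingTheory.Sequence.IsRegular B (List.ofFn f)) (hK1' : IsRegularRing (B ⧸ Ideal.span (Set.range f)))
    (hver : VeroneseNormalised 𝒜 f ![1, 1] d) (β y₃ y₄ h u : B) (hh : IsUnit h) (hu : IsUnit u)
    (G : Set B) (hG : Subring.closure G = ⊤)
    (h0 : ∀ g ∈ G, σ g - g ∈ Ideal.span {β} * (weightedFiltration f ![1, 1]).ideal 1)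
    (hc : ∀ i, σ (f i) - f i ∈ Ideal.span {β} * (weightedFiltration f ![1, 1]).ideal 2)
    (hiso : ∃ N : ℕ, Ideal.span (Set.range f) ^ N ≤ (augmentationIdeal σ).colon (Ideal.span {β}))
    (h₃ : σ y₃ - y₃ - β * h * f 0 ∈ Ideal.span {β} * (weightedFiltration f ![1, 1]).ideal 2)
    (h₄ : σ y₄ - y₄ - β * u * f 1 ∈ Ideal.span {β} * (weightedFiltration f ![1, 1]).ideal 2) :
    RingKillData p r B 𝒜 σ := by
  sorry

/-!
## F6 (research statement, prose only — the scheme-level target these serve)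
`killAdmValReach_at_flagComponent`: at a non-terminal AUX-reachable model `M` of a crux datum, if SOME 2-dimensional bad component `C` (closure of a
`g₀`-fixed point `ξ`) is covered by finitely many `G`-stable affine opens each carrying a flag basis — the data of `ringKillData_smoothTransversalType`
(p636674) with `I = I_C` on the chart, or of F5 — then the conclusion of `KillAdmValReach p` holds at `M` with `c` = the flag valuation at `ξ`
(`v(x₁) = 2, v(x₃) = 1`, resp. the `I_C`-adic order), whose `rees` on each chart is the chartʼs weighted filtration by F1/F2 (resp. F3).
What then remains of K: «every bad point killable (`jInf = ⊥`) ⇒ some component is a flag component» (K-UNIQ; census U-OBS).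
-/

end Summit.ResolutionOfSingularities.ResolutionOfSingularities.Theorems.WildQuotientResolution.S1.FlagSig

end
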